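import Summits.Ventures.QEC.CircuitDistance.ETowerDataX
import Summits.Ventures.QEC.CircuitDistance.ETowerDP
import HarnessLib

/-!
# P3-PORT STEP 2 (E-fold tower), sector X: the BASE KERNEL-WORD COUNTS `#X_w` by the in-kernel weight-enumerator DP
# (ASSEMBLY-SPEC §B9; CARD-7 §1 (iv); cell `qec`, experiment CDX, seat qec-cdx-type-1)

`dpX`: ONE `decide +kernel` run of `ETowerDP.dpCount` over the 45 extended base columns `tab TE3 15` (eng-1's `ETowerDataX`,
= idea-1's `T33`): the numbers of kernel words of `E₃ = E(3,3)·5` by weight `0 … 9`.  `card_Xw_X`: hence `#(Xw (tab TE3 15) 3 3 5 w)`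
for `w ≤ 9` (via `dpCount_eq_card`, columns `< 2^15` decided) — the `hcount` input of `ETowerBase.base_of_slices`.
No `native_decide`; nothing here asserts a value of `d_circ`.
-/

set_option maxRecDepth 100000

namespace Summit.Ventures.QEC.CircuitDistance.ETower.SecX

open Summit.Ventures.QEC.Census Summit.Ventures.QEC.Census.Fold Summit.Ventures.QEC.CircuitDistance.ETower Finset

/-- The base counts `N_w`, `w = 0 … 9` (DATA, checked by `dpX`). -/
def NW : List ℕ := [1, 0, 0, 39, 126, 603, 3945, 21618, 103887, 432155]

set_option maxHeartbeats 4000000000 in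
/-- KERNEL: the weight-enumerator DP over the 45 base columns returns `NW`. -/
theorem dpX : (List.range 10).map (dpCount (tab TE3 15) 45 15 9) = NW := by decide +kernel

/-- KERNEL: the base columns are 15-bit. -/
theorem te3_lt : ((List.range 45).all fun i => decide (tab TE3 15 i < 2 ^ 15)) = true := by decide +kernel

/-- **The number of base kernel words of weight `w ≤ 9` is `NW[w]`.** -/
theorem card_Xw_X {w : ℕ} (hw : w ≤ 9) : #(Xw (tab TE3 15) 3 3 5 w) = NW.getD w 0 := by
  have hcol : ∀ i, i < 45 → tab TE3 15 i < 2 ^ 15 := fun i hi => by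
    have := List.all_eq_true.1 te3_lt i (List.mem_range.2 hi); rwa [decide_eq_true_eq] at this
  rw [Xw_eq_Xw', show 5 * (3 * 3) = 45 from rfl, ← dpCount_eq_card (tab TE3 15) (d := 15) (W := 9) (by norm_num) hcol hw]
  have h := dpX
  have hwl : w < 10 := by omega
  have := congrArg (fun l => l.getD w 0) h
  rw [List.getD_eq_getElem _ _ (by rw [List.length_map, List.length_range]; exact hwl), List.getElem_map, List.getElem_range] at this
  exact this

end Summit.Ventures.QEC.CircuitDistance.ETower.SecX
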